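/-
Copyright (c) 2026 the pub-hodgecm-mathlib formalisation cell (harness21).  Prover seat hodgecm-mathlib-LH4-p13 (g5), req620 Track A «(D-RAM) FOUR-FRAME» squad, unit U2H:
the (ρ2b′-X) child `stub_U2H_fixedPointCensus_typeTwo_unit0` (U2H ED. 15 :418) — seam **S6b «REALIZABILITY»** of the payer LH4-p14 (g4)'s HEAD-OF-ORGANS MAP (hand taken
2026-09-04T04:58Z), companion of the O-Sign organ ★ `F0P3cDyRamTokenSignUnr`.  2026-09-04.
-/
import Literature.NumberTheory.LocalFields.WildQuadraticDatumNormOneDepth    -- ★ p857485 (this seat): `v_norm_sub_one_le∕eq_of_isRamifiedQuadraticDatum` = the E-side inputs `hNle`∕`hNeq` below (along `jE`); brings ★ `v_varpi_pow`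
import HarnessLib

/-!
# Crux `H413`, line LH4 «(D-RAM) FOUR-FRAME» — unit U2H, (ρ2b′-X): seam S6b — REALIZABILITY OF THE TYPE-U TOKENS:
# `(m ≡ d ∧ 1 ≤ m ∧ m + d ≤ jl) ∨ (m = jl − d + 1 ∧ d ≤ jl)` for every deep Θ-unitary `ξ = λ∕u`

Cell `hodgecm-mathlib` (D-0151), FLOOR 0, crux item H413 = `stmt-HodgeConjecture-24833`, route of record `HCCMUnconditional`; squad F0∕P3c∕LH4; registered stub served:
`F0P3cDyRamFourFrameU2H.stub_U2H_fixedPointCensus_typeTwo_unit0` ((ρ2b′-X), U2H ED. 15 :418) through LH4-p14's ★ spine and its HEAD-OF-ORGANS (`hOrgNV_of_organs`): this file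
DISCHARGES the hypothesis `hreal` of ★ `F0P3cDyRamToricCensusSumUnr.toricCensusSum_unr` (and of its v5 re-cut) as a FACT about the descent data of a deep type-(2) `γ_H` of TYPE U,
in the ONE-FIELD letters of the T5a sheet (`lam · Θ lam = 1`, `ρ u = u`, `u · Θ u = 1`, `|lam − u| = exp(−m)`, `|(lam − u) − ρ(lam − u)| = exp(−jl)`).  THEOREMS ONLY (no `def`,
no instance, no notation, no `sorry`); lane `--supports stmt-HodgeConjecture-24833` (count-neutral).

THE MATHEMATICS.  `M` (the Lean `K`) carries commuting isometric involutions `ρ` (fixing `E`) and `Θ` (`Θ|_E = σ`); TYPE U supplies an integral `α ∈ K_desc = Fix(Θρ)` with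
`|α − ρα| = 1` (unramified descent field).  For a Θ-unitary `ξ` (`ξ·Θξ = 1`; `ξ = λ∕u`) write `ξ − 1 = e₀ + e₁α` with `ρ`-fixed `e₀, e₁` (`e₁ = (ξ − ρξ)∕(α − ρα)`, so
`|e₁| = exp(−jl)`, and `|ξ − 1| = max(|e₀|, |e₁|)`).  Comparing `α`-coordinates in `ξ·Θξ = 1` gives **`ξ = (1 + e₀)·(1 + qα)` with `q := e₁∕(1 + e₀) ∈ F`** (`ρq = Θq = q`)
and **`N_{E∕F}(1 + e₀) · N_{K∕F}(1 + qα) = 1`**, whence `|N_{E∕F}(1 + e₀) − 1| = |q·(Tr α + q·Nα)| = |q| = exp(−jl)` (`Tr α` is a unit at a wild place).  The E-side norm-depth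
law (★ `WildQuadraticDatumNormOneDepth`: `|N(1+e) − 1| ≤ |ϖ|^{r+d−1}` for `|e| ≤ |ϖ|^r`, with EQUALITY when `|e| = |ϖ|^r`, `r ≢ d (2)`) then forbids `|e₀| < exp(−jl)` (it would
give `jl ≥ jl + d − 1`), so `|e₀| = exp(−m)`, `jl ≥ m + d − 1`, with `jl = m + d − 1` when `m ≢ d` and `jl ≥ m + d` when `m ≡ d` (`jl` is even: `q ∈ F`) — the two branches of `hreal`.
Evidence: F0P3a-p01 (g32) E1 engine 40∕40 type-U rows; LH4-p14 (g4) token scan 17 285 samples (`m2` odd: 0).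
INTERFACE (head): `hNle`∕`hNeq` are ★ p857485's `v_norm_sub_one_le∕eq_of_isRamifiedQuadraticDatum` transported along `jE : L_w → M` (`jE ∘ σ_w = Θ ∘ jE`, `|jE x| = |x|` for
`M∕L_w` unramified); `hFev` is the datum clause «σ_w-fixed elements have even valuation» along `jE ∘ ι_w`; `α` = an integral generator of the unramified descent field with
`Θα = ρα`.
HONEST LABEL.  Count-neutral helper; (ρ2b′-X) OPEN; `HC_CM` is proved only modulo the 7 printed citations (2 remaining named inputs: hLiu418 = `stmt-HodgeConjecture-24832`, h413 =
`stmt-HodgeConjecture-24833`) until rung 0 closes.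

## References
* [Serre1979] J.-P. Serre, *Local Fields*, GTM 67 (1979), Ch. V §2 Prop. 3, §3 Prop. 5; Ch. III §6.
* [Rogawski1990] J. D. Rogawski, *Automorphic Representations of Unitary Groups in Three Variables*, Ann. of Math. Stud. 123 (1990), §4.9 Prop. 4.9.1 (b) p. 55, Lemma 4.9.3 p. 56.
* [Kottwitz1986BaseChangeUnits] R. E. Kottwitz, *Base change for unit elements of Hecke algebras*, Compositio Math. 60 (1986), §1 pp. 240–241.
-/

set_option autoImplicit false

noncomputable section

open WithZero

namespace Summit.HodgeConjecture.HodgeConjecture.Cruxes.H413.F0P3cDyRamTokenRealizabilityUnr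

variable {K : Type*} [Field K] [Valued K ℤᵐ⁰]

/-! ## §1 Coordinates `e₀ + e₁α` over the `ρ`-fixed field -/

omit [Valued K ℤᵐ⁰] in
/-- **Uniqueness of `ρ`-fixed coordinates**: `A + B·α = 0` with `ρA = A`, `ρB = B`, `ρα ≠ α` forces `B = 0` and `A = 0`. [cite: Serre1979, Ch. III §6] -/
theorem coords_eq_zero {ρ : K →+* K} {α A B : K} (hα : ρ α ≠ α) (hA : ρ A = A) (hB : ρ B = B) (h : A + B * α = 0) : B = 0 ∧ A = 0 := by
  have h2 : A + B * ρ α = 0 := by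
    have h' := congrArg ρ h
    rwa [map_add, map_mul, hA, hB, map_zero] at h'
  have hB0 : B * (α - ρ α) = 0 := by linear_combination h - h2
  have hB' : B = 0 := (mul_eq_zero.1 hB0).resolve_right (sub_ne_zero.2 (Ne.symm hα))
  refine ⟨hB', ?_⟩
  rwa [hB', zero_mul, add_zero] at h

/-- **Valuation splitting**: for `ρ` isometric, `|α| ≤ 1`, `|α − ρα| = 1` and `ρ`-fixed `e₀, e₁`: `|e₀ + e₁α| = max(|e₀|, |e₁|)` (`𝒪_M = 𝒪_E ⊕ 𝒪_E α`).
[cite: Serre1979, Ch. III §6 Prop. 12] -/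
theorem v_coords_eq_max {ρ : K →+* K} (hρv : ∀ x, Valued.v (ρ x) = Valued.v x) {α : K} (hα1 : Valued.v α ≤ 1) (hαρ : Valued.v (α - ρ α) = 1)
    {e₀ e₁ : K} (he₀ : ρ e₀ = e₀) (he₁ : ρ e₁ = e₁) : Valued.v (e₀ + e₁ * α) = max (Valued.v e₀) (Valued.v e₁) := by
  set x := e₀ + e₁ * α with hx
  have hdiff : x - ρ x = e₁ * (α - ρ α) := by rw [hx, map_add, map_mul, he₀, he₁]; ring
  have hve₁ : Valued.v e₁ ≤ Valued.v x := by
    have h : Valued.v (x - ρ x) ≤ Valued.v x := (Valuation.map_sub _ _ _).trans (by rw [hρv, max_self])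
    rwa [hdiff, Valuation.map_mul, hαρ, mul_one] at h
  have hve₀ : Valued.v e₀ ≤ Valued.v x := by
    have h : e₀ = x - e₁ * α := by rw [hx]; ring
    rw [h]
    refine (Valuation.map_sub _ _ _).trans (max_le le_rfl ?_)
    rw [Valuation.map_mul]
    exact (mul_le_of_le_one_right' hα1).trans hve₁
  refine le_antisymm ?_ (max_le hve₀ hve₁)
  refine (Valuation.map_add _ _ _).trans (max_le_max le_rfl ?_)
  rw [Valuation.map_mul]
  exact mul_le_of_le_one_right' hα1

/-! ## §2 REALIZABILITY for a Θ-unitary element -/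

/-- **REALIZABILITY OF THE TYPE-U TOKENS (abstract form).**  `ρ, Θ` commuting involutions (`ρ` isometric) of the valued field `K` (= the biquadratic `M`); `|2| < 1` (wild);
`α` integral with `Θα = ρα` and `|α − ρα| = 1` (TYPE U: unramified descent field `Fix(Θρ)`); `ρ`- and `Θ`-fixed non-zero elements have even valuation (`hFev`); the E-side
norm-depth law for `ρ`-fixed elements (`hNle`, `hNeq`: ★ `WildQuadraticDatumNormOneDepth` along `jE`), `2 ≤ d`.  Then every Θ-unitary `ξ` with `|ξ − 1| = exp(−m)`,
`|ξ − ρξ| = exp(−jl)`, `d ≤ m` satisfies `(m ≡ d (2) ∧ 1 ≤ m ∧ m + d ≤ jl) ∨ (m = jl − d + 1 ∧ d ≤ jl)`. [cite: Serre1979, Ch. V §3 Prop. 5; Ch. V §2 Prop. 3]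
[cite: Rogawski1990, §4.9 Lemma 4.9.3 p. 56] -/
theorem realizable_of_thetaUnitary {ρ Θ : K →+* K} (hρρ : ∀ x, ρ (ρ x) = x) (hΘΘ : ∀ x, Θ (Θ x) = x) (hρΘ : ∀ x, ρ (Θ x) = Θ (ρ x))
    (hρv : ∀ x, Valued.v (ρ x) = Valued.v x)
    {ϖE : K} (hϖE : Valued.v ϖE = exp (-1 : ℤ)) (h2 : Valued.v (2 : K) < 1)
    {α : K} (hΘα : Θ α = ρ α) (hα1 : Valued.v α ≤ 1) (hαρ : Valued.v (α - ρ α) = 1)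
    (hFev : ∀ x : K, ρ x = x → Θ x = x → x ≠ 0 → ∃ n : ℤ, Valued.v x = exp (2 * n))
    {d : ℕ} (hd2 : 2 ≤ d)
    (hNle : ∀ e : K, ρ e = e → ∀ r : ℕ, d ≤ r + 1 → Valued.v e ≤ Valued.v ϖE ^ r → Valued.v (e + Θ e + e * Θ e) ≤ Valued.v ϖE ^ (r + d - 1))
    (hNeq : ∀ e : K, ρ e = e → ∀ r : ℕ, d ≤ r → Valued.v e = Valued.v ϖE ^ r → r % 2 ≠ d % 2 →
      Valued.v (e + Θ e + e * Θ e) = Valued.v ϖE ^ (r + d - 1))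
    {ξ : K} (hξ : ξ * Θ ξ = 1) {m jl : ℕ} (hdm : d ≤ m)
    (hm : Valued.v (ξ - 1) = exp (-(m : ℤ))) (hjl : Valued.v (ξ - ρ ξ) = exp (-(jl : ℤ))) :
    (m % 2 = d % 2 ∧ 1 ≤ m ∧ m + d ≤ jl) ∨ (m = jl - d + 1 ∧ d ≤ jl) := by
  have hπ : ∀ n : ℕ, Valued.v ϖE ^ n = exp (-(n : ℤ)) := Literature.NumberTheory.LocalFields.WildQuadraticDatum.v_varpi_pow hϖE
  have hαne : ρ α ≠ α := fun h => by rw [h, sub_self, map_zero] at hαρ; exact zero_ne_one hαρ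
  have hαρ0 : α - ρ α ≠ 0 := sub_ne_zero.2 (Ne.symm hαne)
  -- ## coordinates of `ξ − 1`
  obtain ⟨e₀, e₁, he₀, he₁, hηco⟩ := Literature.NumberTheory.LocalFields.exists_fixed_coords_of_map_ne hρρ hαne (ξ - 1)
  have hΘe₀ : ρ (Θ e₀) = Θ e₀ := by rw [hρΘ, he₀]
  have hΘe₁ : ρ (Θ e₁) = Θ e₁ := by rw [hρΘ, he₁]
  have hηρ : ξ - ρ ξ = e₁ * (α - ρ α) := by
    have h : (ξ - 1) - ρ (ξ - 1) = ξ - ρ ξ := by rw [map_sub ρ, map_one ρ]; ring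
    rw [← h, hηco, map_add, map_mul, he₀, he₁]; ring
  -- `|e₁| = exp(−jl)`, `|ξ − 1| = max(|e₀|, |e₁|) = exp(−m)`
  have hve₁ : Valued.v e₁ = exp (-(jl : ℤ)) := by
    have h : Valued.v (ξ - ρ ξ) = Valued.v e₁ := by rw [hηρ, Valuation.map_mul, hαρ, mul_one]
    rw [← h, hjl]
  have hmax : max (Valued.v e₀) (Valued.v e₁) = exp (-(m : ℤ)) := by
    rw [← v_coords_eq_max hρv hα1 hαρ he₀ he₁, ← hηco, hm]
  have hmjl : m ≤ jl := by
    have h : Valued.v e₁ ≤ exp (-(m : ℤ)) := hmax ▸ le_max_right _ _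
    rw [hve₁, exp_le_exp] at h; omega
  -- ## the factorisation `ξ = (1 + e₀)(1 + qα)` from the `α`-coordinate of `ξ·Θξ = 1`
  have hξco : ξ = 1 + e₀ + e₁ * α := by linear_combination hηco
  have hΘξ : Θ ξ = 1 + Θ e₀ + Θ e₁ * ρ α := by
    rw [hξco, map_add, map_add, map_one, map_mul, hΘα]
  have hτ : ρ (α + ρ α) = α + ρ α := by rw [map_add, hρρ, add_comm]
  have hn : ρ (α * ρ α) = α * ρ α := by rw [map_mul, hρρ, mul_comm]
  have hkey : ((1 + e₀) * (1 + Θ e₀) + (1 + e₀) * Θ e₁ * (α + ρ α) + e₁ * Θ e₁ * (α * ρ α) - 1) +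
      (e₁ * (1 + Θ e₀) - (1 + e₀) * Θ e₁) * α = 0 := by
    have h : (1 + e₀ + e₁ * α) * (1 + Θ e₀ + Θ e₁ * ρ α) = 1 := by rw [← hΘξ, ← hξco]; exact hξ
    linear_combination h
  have hA : ρ ((1 + e₀) * (1 + Θ e₀) + (1 + e₀) * Θ e₁ * (α + ρ α) + e₁ * Θ e₁ * (α * ρ α) - 1) =
      (1 + e₀) * (1 + Θ e₀) + (1 + e₀) * Θ e₁ * (α + ρ α) + e₁ * Θ e₁ * (α * ρ α) - 1 := by
    simp only [map_sub, map_add, map_mul, map_one, he₀, he₁, hΘe₀, hΘe₁, hτ, hn]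
  have hB : ρ (e₁ * (1 + Θ e₀) - (1 + e₀) * Θ e₁) = e₁ * (1 + Θ e₀) - (1 + e₀) * Θ e₁ := by
    simp only [map_sub, map_add, map_mul, map_one, he₀, he₁, hΘe₀, hΘe₁]
  obtain ⟨hP₁, hP₀⟩ := coords_eq_zero hαne hA hB hkey
  -- units: `|e₀| < 1`, `1 + e₀ ≠ 0`, `1 + Θe₀ ≠ 0`
  have hm1 : 1 ≤ m := le_trans (by omega) hdm
  have hve₀lt : Valued.v e₀ < 1 := by
    refine lt_of_le_of_lt (hmax ▸ le_max_left _ _ : Valued.v e₀ ≤ exp (-(m : ℤ))) ?_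
    rw [← exp_zero, exp_lt_exp]; omega
  have hε0 : (1 + e₀) ≠ 0 := fun h => by
    have h' : e₀ = -1 := by linear_combination h
    rw [h', Valuation.map_neg, Valuation.map_one] at hve₀lt
    exact lt_irrefl _ hve₀lt
  have hΘε0 : (1 + Θ e₀) ≠ 0 := fun h => by
    have h' := congrArg Θ h
    rw [map_add, map_one, hΘΘ, map_zero] at h'
    exact hε0 h'
  have hvε : Valued.v (1 + e₀) = 1 := by
    rw [Valuation.map_add_eq_of_lt_left _ (by rw [Valuation.map_one]; exact hve₀lt), Valuation.map_one]
  -- `q := e₁ ∕ (1 + e₀)` is `ρ`- and `Θ`-fixed with `|q| = exp(−jl)`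
  set q := e₁ / (1 + e₀) with hqdef
  have hρq : ρ q = q := by rw [hqdef, map_div₀, he₁, map_add, map_one, he₀]
  have hΘq : Θ q = q := by
    rw [hqdef, map_div₀, map_add, map_one, div_eq_div_iff hΘε0 hε0]
    linear_combination -hP₁
  have hvq : Valued.v q = exp (-(jl : ℤ)) := by rw [hqdef, map_div₀, hvε, div_one, hve₁]
  have hq0 : q ≠ 0 := fun h => by rw [h, map_zero] at hvq; exact exp_ne_zero hvq.symm
  -- `jl` is even
  obtain ⟨nq, hnq⟩ := hFev q hρq hΘq hq0
  have hjlev : ∃ k : ℤ, (jl : ℤ) = 2 * k := ⟨-nq, by rw [hvq, exp_inj] at hnq; omega⟩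
  -- `W := N_E(1 + e₀) − 1` has `|W| = |q| = exp(−jl)`
  set W := e₀ + Θ e₀ + e₀ * Θ e₀ with hWdef
  have he₁q : e₁ = q * (1 + e₀) := by rw [hqdef, div_mul_cancel₀ _ hε0]
  have hΘe₁q : Θ e₁ = q * (1 + Θ e₀) := by rw [he₁q, map_mul, hΘq, map_add, map_one]
  have hWeq : W * (1 + q * (α + ρ α) + q ^ 2 * (α * ρ α)) = -(q * ((α + ρ α) + q * (α * ρ α))) := by
    have h := hP₀
    rw [hΘe₁q, he₁q] at h
    rw [hWdef]
    linear_combination h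
  have hvq1 : Valued.v q < 1 := by
    rw [hvq, ← exp_zero, exp_lt_exp]; omega
  have hvτ : Valued.v (α + ρ α) = 1 := by
    have h : α + ρ α = (α - ρ α) + 2 * ρ α := by ring
    rw [h]
    refine (Valuation.map_add_eq_of_lt_left _ ?_).trans hαρ
    rw [hαρ, Valuation.map_mul, hρv]
    calc Valued.v (2 : K) * Valued.v α ≤ Valued.v (2 : K) * 1 := by gcongr
      _ < 1 := by rw [mul_one]; exact h2
  have hvn : Valued.v (α * ρ α) ≤ 1 := by
    rw [Valuation.map_mul, hρv]; exact mul_le_one' hα1 hα1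
  have hvτ' : Valued.v ((α + ρ α) + q * (α * ρ α)) = 1 := by
    refine (Valuation.map_add_eq_of_lt_left _ ?_).trans hvτ
    rw [hvτ, Valuation.map_mul]
    calc Valued.v q * Valued.v (α * ρ α) ≤ Valued.v q * 1 := by gcongr
      _ < 1 := by rw [mul_one]; exact hvq1
  have hvden : Valued.v (1 + q * (α + ρ α) + q ^ 2 * (α * ρ α)) = 1 := by
    have hsmall : Valued.v (q * (α + ρ α) + q ^ 2 * (α * ρ α)) < 1 := by
      refine lt_of_le_of_lt (Valuation.map_add _ _ _) (max_lt ?_ ?_)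
      · rw [Valuation.map_mul, hvτ, mul_one]; exact hvq1
      · rw [Valuation.map_mul, Valuation.map_pow]
        calc Valued.v q ^ 2 * Valued.v (α * ρ α) ≤ Valued.v q ^ 2 * 1 := by gcongr
          _ < 1 := by rw [mul_one]; exact pow_lt_one₀ zero_le hvq1 two_ne_zero
    rw [add_assoc, Valuation.map_add_eq_of_lt_left _ (by rw [Valuation.map_one]; exact hsmall), Valuation.map_one]
  have hvW : Valued.v W = exp (-(jl : ℤ)) := by
    have h := congrArg Valued.v hWeq
    rw [Valuation.map_mul, hvden, mul_one, Valuation.map_neg, Valuation.map_mul, hvτ', mul_one, hvq] at h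
    exact h
  -- ## the E-side norm-depth law decides
  have hcase : Valued.v e₀ = exp (-(m : ℤ)) := by
    rcases le_or_gt (exp (-(jl : ℤ))) (Valued.v e₀) with h | h
    · -- `|e₀| ≥ |e₁|`: the max is `|e₀|`
      rw [← hmax, hve₁, max_eq_left h]
    · -- `|e₀| < exp(−jl)`: then `m = jl` and the depth law is violated
      exfalso
      have hmj : exp (-(m : ℤ)) = exp (-(jl : ℤ)) := by rw [← hmax, hve₁, max_eq_right h.le]
      have hle := hNle e₀ he₀ jl (by rw [exp_inj] at hmj; omega) (by rw [hπ]; exact h.le)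
      rw [← hWdef, hvW, hπ, exp_le_exp] at hle
      omega
  have hge : m + d - 1 ≤ jl := by
    have hle := hNle e₀ he₀ m (by omega) (by rw [hπ, hcase])
    rw [← hWdef, hvW, hπ, exp_le_exp] at hle
    omega
  by_cases hpar : m % 2 = d % 2
  · left
    refine ⟨hpar, hm1, ?_⟩
    obtain ⟨k, hk⟩ := hjlev
    omega
  · right
    have heq := hNeq e₀ he₀ m hdm (by rw [hπ, hcase]) hpar
    rw [← hWdef, hvW, hπ, exp_inj] at heq
    omega

/-! ## §3 The T5a letters: `ξ = lam ∕ u` -/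

/-- **REALIZABILITY IN THE SHEET'S LETTERS** (`hreal` of ★ `toricCensusSum_unr` as a fact): for `lam` Θ-unitary (`lam·Θ lam = 1`), `u ∈ E¹` (`ρu = u`, `u·Θu = 1`),
`μ := lam − u` with `|μ| = exp(−m)`, `|μ − ρμ| = exp(−jl)`, `d ≤ m`, under the abstract type-U hypotheses of ★ `realizable_of_thetaUnitary`:
`(m ≡ d (2) ∧ 1 ≤ m ∧ m + d ≤ jl) ∨ (m = jl − d + 1 ∧ d ≤ jl)` (apply it to `ξ := lam∕u`: `μ = u(ξ − 1)`, `μ − ρμ = u(ξ − ρξ)`, `|u| = 1`).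
[cite: Serre1979, Ch. V §3 Prop. 5] [cite: Rogawski1990, §4.9 Lemma 4.9.3 p. 56] [cite: Kottwitz1986BaseChangeUnits, §1 pp. 240–241] -/
theorem realizable_of_frame {ρ Θ : K →+* K} (hρρ : ∀ x, ρ (ρ x) = x) (hΘΘ : ∀ x, Θ (Θ x) = x) (hρΘ : ∀ x, ρ (Θ x) = Θ (ρ x))
    (hρv : ∀ x, Valued.v (ρ x) = Valued.v x) (hΘv : ∀ x, Valued.v (Θ x) = Valued.v x)
    {ϖE : K} (hϖE : Valued.v ϖE = exp (-1 : ℤ)) (h2 : Valued.v (2 : K) < 1)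
    {α : K} (hΘα : Θ α = ρ α) (hα1 : Valued.v α ≤ 1) (hαρ : Valued.v (α - ρ α) = 1)
    (hFev : ∀ x : K, ρ x = x → Θ x = x → x ≠ 0 → ∃ n : ℤ, Valued.v x = exp (2 * n))
    {d : ℕ} (hd2 : 2 ≤ d)
    (hNle : ∀ e : K, ρ e = e → ∀ r : ℕ, d ≤ r + 1 → Valued.v e ≤ Valued.v ϖE ^ r → Valued.v (e + Θ e + e * Θ e) ≤ Valued.v ϖE ^ (r + d - 1))
    (hNeq : ∀ e : K, ρ e = e → ∀ r : ℕ, d ≤ r → Valued.v e = Valued.v ϖE ^ r → r % 2 ≠ d % 2 →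
      Valued.v (e + Θ e + e * Θ e) = Valued.v ϖE ^ (r + d - 1))
    {lam u : K} (hlam : lam * Θ lam = 1) (hu : ρ u = u) (hu1 : u * Θ u = 1)
    {m jl : ℕ} (hdm : d ≤ m) (hm : Valued.v (lam - u) = exp (-(m : ℤ))) (hjl : Valued.v ((lam - u) - ρ (lam - u)) = exp (-(jl : ℤ))) :
    (m % 2 = d % 2 ∧ 1 ≤ m ∧ m + d ≤ jl) ∨ (m = jl - d + 1 ∧ d ≤ jl) := by
  have hu0 : u ≠ 0 := fun h => by rw [h, zero_mul] at hu1; exact zero_ne_one hu1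
  have hvu : Valued.v u = 1 := by
    have h : Valued.v u * Valued.v u = 1 := by
      have h' := congrArg Valued.v hu1
      rwa [Valuation.map_mul, hΘv, Valuation.map_one] at h'
    rcases lt_trichotomy (Valued.v u) 1 with h1 | h1 | h1
    · exfalso
      have hlt : Valued.v u * Valued.v u < 1 :=
        calc Valued.v u * Valued.v u ≤ Valued.v u * 1 := by gcongr
          _ < 1 := by rw [mul_one]; exact h1
      rw [h] at hlt; exact lt_irrefl _ hlt
    · exact h1
    · exfalso
      have hlt : 1 < Valued.v u * Valued.v u :=
        calc (1 : ℤᵐ⁰) < Valued.v u := h1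
          _ = Valued.v u * 1 := (mul_one _).symm
          _ ≤ Valued.v u * Valued.v u := by gcongr
      rw [h] at hlt; exact lt_irrefl _ hlt
  have hξ : (lam / u) * Θ (lam / u) = 1 := by
    rw [map_div₀, div_mul_div_comm, hlam, hu1, div_one]
  have hm' : Valued.v (lam / u - 1) = exp (-(m : ℤ)) := by
    have h : lam / u - 1 = (lam - u) / u := by field_simp
    rw [h, map_div₀, hvu, div_one, hm]
  have hjl' : Valued.v (lam / u - ρ (lam / u)) = exp (-(jl : ℤ)) := by
    have h : lam / u - ρ (lam / u) = ((lam - u) - ρ (lam - u)) / u := by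
      rw [map_div₀, hu, map_sub, hu]; field_simp; ring
    rw [h, map_div₀, hvu, div_one, hjl]
  exact realizable_of_thetaUnitary hρρ hΘΘ hρΘ hρv hϖE h2 hΘα hα1 hαρ hFev hd2 hNle hNeq hξ hdm hm' hjl'

end Summit.HodgeConjecture.HodgeConjecture.Cruxes.H413.F0P3cDyRamTokenRealizabilityUnr

end
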